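import Mathlib
import Summits.Ventures.PercRepro2.Defs
import Summits.Ventures.PercRepro2.Independence
import Summits.Ventures.PercRepro2.Harris
import Summits.Ventures.PercRepro2.Graph
import Summits.Ventures.PercRepro2.Exploration
import Summits.Ventures.PercRepro2.Induced
import Summits.Ventures.PercRepro2.R1Rung
import Summits.Ventures.PercRepro2.CC2Rung
import Summits.Ventures.PercRepro2.MonoT
import Summits.Ventures.PercRepro2.Events
import Summits.Ventures.PercRepro2.FourFunctions
import Summits.Ventures.PercRepro2.Frontier
import Summits.Ventures.PercRepro2.ObsIndependence
import Summits.Ventures.PercRepro2.BHK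
import Summits.Ventures.PercRepro2.BHKEvents
import Summits.Ventures.PercRepro2.MultiSource
import Summits.Ventures.PercRepro2.OrderPreservation
import Summits.Ventures.PercRepro2.SeedSet
import Summits.Ventures.PercRepro2.MultiSourceFun
import Summits.Ventures.PercRepro2.CrossRootT
import Summits.Ventures.PercRepro2.VdBKahn
import Summits.Ventures.PercRepro2.HullDefs
import Summits.Ventures.PercRepro2.CCTRootEdge
import Summits.Ventures.PercRepro2.CCTAvoidedEdge

/-!
# (CC-T) at `T` from (MONO-u) and the avoided-edge rung (blind cell PercRepro2, typer-1; lead g11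
11:18:29Z "the reduction (CC-T) at T ⟸ (MONO-u) + ccT_avoided_edge is the interesting part";
mine-c g3 §10.8)

For `e = {u, w}` free and `T′ = T ∪ {u}`, the rung at `T′` is the avoided-edge case
`CCT.ccT_avoided_edge` (a theorem), so `S(T′) ≥ 0`; (MONO-u) at the step `T → T′` reads
`P₁(T′) S(T′) P₀(T)² ≤ P₁(T) S(T) P₀(T′)²`, whose left side is then `≥ 0`; with `P₀(T′) > 0` this
forces `P₁(T) S(T) ≥ 0`, and `P₁(T) = 0` kills `S(T)` outright. Hence **`CC2_of_monoU`**: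
`(MONO-u) at (T, u) ⟹ (CC-T) at T` whenever `P₀(T ∪ {u}) > 0` (the degenerate case
`P₀(T ∪ {u}) = 0` — `s` reaches `u` or `T` almost surely with `e` closed — is excluded by hypothesis).
So the first rung reduces, one vertex at a time, to the monotone potential.
-/

namespace Summit.Ventures.PercRepro2

namespace MonoT

open TwoSetRung

variable {V : Type*} {E : Type*} [Fintype E] [DecidableEq E] [Fintype V] [DecidableEq V]
  {R : Type*} [Field R] [LinearOrder R] [IsStrictOrderedRing R]

variable (p : E → R) (ends : E → Sym2 V) {e : E} (s : V) (A B : Finset V) (T : Finset V)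

omit [Fintype V] in
/-- `P₁ = 0` forces the rung slack to vanish. -/
lemma rungSlack_eq_zero_of_massP_one_eq_zero (hp : IsProbVec p)
    (h : massP (Function.update p e 1) ends s T = 0) : rungSlack p ends e s A B T = 0 := by
  have hp₁ : IsProbVec (Function.update p e 1) := hp.update e zero_le_one le_rfl
  have hle : ∀ X : Finset V, massF (Function.update p e 1) ends s X T = 0 := by
    intro X
    refine le_antisymm ?_ (prob_nonneg hp₁ _)
    rw [← h]
    exact prob_mono hp₁ Set.inter_subset_left
  unfold rungSlack
  rw [hle, hle, hle, h]
  ring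

/-- **(CC-T) at `T` from (MONO-u) at `(T, u)`** for a free edge `e = {u, w}`, given
`P₀(T ∪ {u}) > 0`: the rung at `T ∪ {u}` is `ccT_avoided_edge`, and the monotone potential carries
its sign down to `T`. -/
theorem CC2_of_monoU (hp : IsProbVec p) {u w : V} (hends : ends e = s(u, w))
    (hmono : MonoU p ends e s A B T u)
    (hpos : 0 < massP (Function.update p e 0) ends s (insert u T)) :
    CC2 p ends e s A B T T := by
  have hp₀ : IsProbVec (Function.update p e 0) := hp.update e le_rfl zero_le_one
  have hp₁ : IsProbVec (Function.update p e 1) := hp.update e zero_le_one le_rfl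
  -- the rung at `T ∪ {u}`: the avoided-edge theorem
  have hT' : CC2 p ends e s A B (insert u T) (insert u T) :=
    CCT.ccT_avoided_edge p ends hp hends s (Finset.mem_insert_self u T) A B
  rw [CC2_iff_rungSlack_nonneg] at hT' ⊢
  unfold MonoU at hmono
  have hP1' : 0 ≤ massP (Function.update p e 1) ends s (insert u T) := prob_nonneg hp₁ _
  have hP0 : 0 ≤ massP (Function.update p e 0) ends s T := prob_nonneg hp₀ _
  have hP1 : 0 ≤ massP (Function.update p e 1) ends s T := prob_nonneg hp₁ _
  have hlhs : 0 ≤ massP (Function.update p e 1) ends s (insert u T) *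
      rungSlack p ends e s A B (insert u T) * massP (Function.update p e 0) ends s T ^ 2 :=
    mul_nonneg (mul_nonneg hP1' hT') (sq_nonneg _)
  have hprod : 0 ≤ massP (Function.update p e 1) ends s T * rungSlack p ends e s A B T := by
    have h2 : 0 < massP (Function.update p e 0) ends s (insert u T) ^ 2 := pow_pos hpos 2
    have := hlhs.trans hmono
    exact (mul_nonneg_iff_of_pos_right h2).1 this
  rcases hP1.lt_or_eq with hlt | heq
  · exact (mul_nonneg_iff_of_pos_left hlt).1 hprod
  · rw [rungSlack_eq_zero_of_massP_one_eq_zero p ends s A B T hp heq.symm]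

end MonoT

end Summit.Ventures.PercRepro2
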